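import Literature.NumberTheory.EllipticCurves.AnomalousOfRationalTorsionProofs
import Literature.NumberTheory.EllipticCurves.GoodReductionTorsionReductionProofs
import Literature.NumberTheory.EllipticCurves.MazurTorsionOrderValuationProofs
import Literature.NumberTheory.EllipticCurves.LFunctionPrimeCoeff
import Literature.NumberTheory.EllipticCurves.CuspFormLFunction
import HarnessLib

/-!
# Route `TwoAdicConverse` (rung S3), crux `OrdLambdaHalfAtTwo` (item 19556), line `gv-analytic-two`:
# the Eisenstein congruence MODULO THE TORSION ORDER — `#E(ℚ)_tors ∣ #Ẽ(𝔽_ℓ)`, i.e. `a_ℓ ≡ 1 + ℓ (mod #E(ℚ)_tors)`,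
# at every odd prime `ℓ` of good reduction

Cell `bsd-2adic` (run/shared/lean/pub/bsd-2adic/), seat `bsd-2adic-conv-1` (GEN 5); sequel of p455795
(`TwoAdicConverseEisensteinCongruenceModFour`: `E[2] ⊂ E(ℚ) ⇒ 4 ∣ ℓ + 1 − a_ℓ`). THEOREMS ONLY — no named fact, no axiom, no
definition; UNCONDITIONAL. HONEST FRAMING: the DEPTH of the `2`-adic Eisenstein congruence on the reducible-`E[2]` habitat of
item 19556 is governed by `#E(ℚ)[2^∞]`, not by `E[2]` alone: a curve with `E(ℚ)_tors ⊇ ℤ/2 × ℤ/2^k` has `a_ℓ ≡ 1 + ℓ (mod 2^{k+1})`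
(by Mazur, `k ≤ 3`: up to `mod 16`). This file proves the general classical statement behind it; it proves nothing about `λ`;
item 19556 / Kato's IMC at `2` stay OPEN class-wide; BSD is not proved by any of this. PARTITION (D-0054): none — RANK axis (S3);
companion formula cell X5@2 good-ord (B1·O1).

**Statements** (`W/ℚ` globally minimal elliptic, `ℓ ≥ 3` a prime of GOOD reduction, `N_ℓ = #W̃(𝔽_ℓ) = reductionPointCount W ℓ`,
`a_ℓ = frobeniusTrace W ℓ = ℓ + 1 − N_ℓ`, `#E(ℚ)_tors = W.torsionOrder`).
* **`torsionOrder_dvd_reductionPointCount`** — `#E(ℚ)_tors ∣ #W̃(𝔽_ℓ)`: the composite `E(ℚ)_tors ⊂ E(ℚ) → E(ℚ_ℓ) → W̃(𝔽_ℓ)`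
  (tree `toPadicPoint`, `exists_reductionHom`) is an INJECTIVE homomorphism, because its kernel lies in `E₁(ℚ_ℓ) ∩ E(ℚ)`, which
  has no torsion for `ℓ ≥ 3` (Silverman AEC VII.3.1(b)/IV.6.1; tree fact-discharge `not_isOfFinAddOrder_of_one_lt_padicNorm_holds`);
  then Lagrange. (The tree had the element-wise form `addOrderOf T ∣ N_ℓ` — `AnomalousOfRationalTorsionProofs` — which bounds
  `N_ℓ` only by the EXPONENT of `E(ℚ)_tors`; for `ℤ/2 × ℤ/2n` the order `4n` is the sharper modulus.)
* **`torsionOrder_dvd_succ_sub_frobeniusTrace`** / `frobeniusTrace_modEq_succ_torsionOrder` — `a_ℓ ≡ ℓ + 1 (mod #E(ℚ)_tors)`;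
  `torsionOrder_dvd_succ_sub_lFunction` (Dirichlet coefficient of `L(E,s)`); `exists_cuspCoeff_eq_of_torsionOrder` (any newform
  `f` of `E`: `a_ℓ(f) = ℓ + 1 + #E(ℚ)_tors · m`) — `f_E ≡ E₂ (mod #E(ℚ)_tors)` on the Hecke operators `T_ℓ`, `ℓ ∤ 2N`.

References: J. H. Silverman, *The Arithmetic of Elliptic Curves*, GTM 106 (2009), VII.3.1(b), VII.3.4, IV.6.1, VIII.7.1
[SilvermanAEC2009]; B. Mazur, *Modular curves and the Eisenstein ideal*, Publ. IHÉS 47 (1977), III.§5 (torsion and Eisenstein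
primes) [Mazur1977]; N. Katz, *Galois properties of torsion points on abelian varieties*, Invent. Math. 62 (1981), §1 (the
converse direction) [Katz1981].
-/

set_option linter.dupNamespace false
set_option autoImplicit false

noncomputable section

open scoped Classical
open WeierstrassCurve Literature.NumberTheory.EllipticCurves Literature.NumberTheory.EllipticCurves.ModularForms

namespace Summit.BirchSwinnertonDyer.BirchSwinnertonDyer.Theorems.TwoAdicTwistConverse

variable (W : WeierstrassCurve ℚ) [W.IsElliptic] [W.IsGloballyMinimal] (ℓ : ℕ) [Fact ℓ.Prime]

/-- **`#E(ℚ)_tors ∣ #W̃(𝔽_ℓ)` at every prime `ℓ ≥ 3` of good reduction** of a globally minimal elliptic curve over `ℚ`: the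
composite `E(ℚ)_tors ⊂ E(ℚ) → E(ℚ_ℓ) → W̃(𝔽_ℓ)` is an injective homomorphism (its kernel lies in `E₁(ℚ_ℓ) ∩ E(ℚ)`, torsion-free
for `ℓ ≥ 3`), then Lagrange. [cite: SilvermanAEC2009, VII.3.1(b) and VII.3.4] -/
theorem torsionOrder_dvd_reductionPointCount (hℓ : 3 ≤ ℓ) (hgood : W.HasGoodReductionAtPrime ℓ) :
    W.torsionOrder ∣ W.reductionPointCount ℓ := by
  have hΔ : ¬ (ℓ : ℤ) ∣ minimalDiscriminantInt W :=
    not_dvd_minimalDiscriminantInt_of_hasGoodReductionAtPrime' W ℓ hgood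
  obtain ⟨r, hr⟩ := WeierstrassCurve.exists_reductionHom (W := W) (q := ℓ) hΔ
  set T := AddCommGroup.torsion W.toAffine.Point with hT
  let f := (r.comp (W.toPadicPoint ℓ)).comp T.subtype
  have hf : Function.Injective f := by
    rw [injective_iff_map_eq_zero]
    rintro ⟨t, ht⟩ h0
    have hfin : IsOfFinAddOrder t := (AddCommGroup.mem_torsion _).mp ht
    have hker : (W.baseChange ℚ_[ℓ]).IsInReductionKernel (W.toPadicPoint ℓ t) := by
      rw [← reducePoint_congrEquiv_eq_zero_iff hΔ, ← hr]
      exact h0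
    rcases t with _ | ⟨x, y, h⟩
    · rfl
    · exfalso
      rw [toPadicPoint_some, isInReductionKernel_some] at hker
      exact not_isOfFinAddOrder_of_one_lt_padicNorm_holds W ℓ hℓ h hker hfin
  have hdvd := AddSubgroup.card_dvd_of_injective f hf
  rw [natCard_point_padicModel_residue] at hdvd
  rwa [torsionOrder_eq_natCard_torsion]

/-- **The Eisenstein congruence modulo the torsion order: `#E(ℚ)_tors ∣ ℓ + 1 − a_ℓ`** at every prime `ℓ ≥ 3` of good
reduction (`a_ℓ = frobeniusTrace W ℓ = ℓ + 1 − #W̃(𝔽_ℓ)`). [cite: SilvermanAEC2009, VII.3.1(b) and V.2.3.1] -/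
theorem torsionOrder_dvd_succ_sub_frobeniusTrace (hℓ : 3 ≤ ℓ) (hgood : W.HasGoodReductionAtPrime ℓ) :
    (W.torsionOrder : ℤ) ∣ (ℓ : ℤ) + 1 - W.frobeniusTrace ℓ := by
  have h := torsionOrder_dvd_reductionPointCount W ℓ hℓ hgood
  rw [WeierstrassCurve.frobeniusTrace, sub_sub_cancel]
  exact_mod_cast h

/-- `a_ℓ ≡ ℓ + 1 (mod #E(ℚ)_tors)`, `Int.ModEq` form. [cite: SilvermanAEC2009, VII.3.1(b) and V.2.3.1] -/
theorem frobeniusTrace_modEq_succ_torsionOrder (hℓ : 3 ≤ ℓ) (hgood : W.HasGoodReductionAtPrime ℓ) :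
    W.frobeniusTrace ℓ ≡ (ℓ : ℤ) + 1 [ZMOD W.torsionOrder] :=
  (Int.modEq_iff_dvd.mpr (torsionOrder_dvd_succ_sub_frobeniusTrace W ℓ hℓ hgood))

/-- **`#E(ℚ)_tors ∣ ℓ + 1 − a_ℓ(E)` for the Dirichlet coefficient of `L(E, s)`** (`WeierstrassCurve.LFunction`; tree
`LFunction_apply_prime_eq_frobeniusTrace`). [cite: SilvermanAEC2009, VII.3.1(b) and Exercise 8.19(a)] -/
theorem torsionOrder_dvd_succ_sub_lFunction (hℓ : 3 ≤ ℓ) (hgood : W.HasGoodReductionAtPrime ℓ) :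
    (W.torsionOrder : ℤ) ∣ (ℓ : ℤ) + 1 - W.LFunction ℓ := by
  rw [W.LFunction_apply_prime_eq_frobeniusTrace ℓ hgood]
  exact torsionOrder_dvd_succ_sub_frobeniusTrace W ℓ hℓ hgood

/-- **`f_E ≡ E₂ (mod #E(ℚ)_tors)` on `T_ℓ`**: for any newform `f` of `E` (`IsNewformOf W f`), `a_ℓ(f) = ℓ + 1 + #E(ℚ)_tors · m`
for some `m ∈ ℤ`, at every prime `ℓ ≥ 3` of good reduction. [cite: Mazur1977, III.§5 (rational torsion and Eisenstein primes)]
[cite: SilvermanAEC2009, VII.3.1(b)] -/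
theorem exists_cuspCoeff_eq_of_torsionOrder {N : ℕ} [NeZero N] {f : CuspForm (CongruenceSubgroup.Gamma0 N) 2}
    (hf : IsNewformOf W f) (hℓ : 3 ≤ ℓ) (hgood : W.HasGoodReductionAtPrime ℓ) :
    ∃ m : ℤ, cuspCoeff f ℓ = (((ℓ : ℤ) + 1 + (W.torsionOrder : ℤ) * m : ℤ) : ℂ) := by
  obtain ⟨k, hk⟩ := torsionOrder_dvd_succ_sub_lFunction W ℓ hℓ hgood
  refine ⟨-k, ?_⟩
  rw [hf.2 ℓ]
  have : W.LFunction ℓ = (ℓ : ℤ) + 1 + (W.torsionOrder : ℤ) * (-k) := by linear_combination -hk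
  rw [this]

end Summit.BirchSwinnertonDyer.BirchSwinnertonDyer.Theorems.TwoAdicTwistConverse

end
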